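import Summits.CriticalPhenomena.CardyFormulaZ2.Theorems.SegmentOpen.Negative.NormOne

/-!
# `SegmentOpen` (stmt-CriticalPhenomena-5471), line `Sketch`: marginality does not give uniform
# analyticity — `stub_uniformComplexBound` is NOT a consequence of the crux hypothesis

Negative-side support for the crux `CardySelfDualSegment.SegmentOpen` (cdisprove unit, cycle 2; work
file `Cruxes/SegmentOpen/Disproof.lean`, §5).  The crux's only hypothesis is `UniformMarginality`
(UM: equicontinuity of `t ↦ P_t(R, δ)` on `[0,1]`, uniformly in the mesh).  Line `Sketch` replaces it
by the much stronger `stub_uniformComplexBound` (UA: the crossing polynomials `p_{R,δ}` are bounded on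
ONE complex disc around each `t₀ ∈ [0,1]`, uniformly in `δ`).  This file records, kernel-checked, that
UA does not follow from UM even for `[0,1]`-valued polynomial families that are uniformly LIPSCHITZ on
`[0,1]`: the family `p_n(t) = (4t(1-t))^{n+1}/(n+1)` takes values in `[0,1]` on `[0,1]`, is
`4`-Lipschitz there for every `n` (so it has the UM shape with `η = ε/4`), but
`p_n(1/2 + iy) = (1+4y²)^{n+1}/(n+1) → ∞` for every real `y ≠ 0`: it is unbounded on every complex
disc around `t₀ = 1/2` (`exists_marginal_family_not_uniformComplexBound`,
`not_uniformComplexBound_of_marginal_abstract`).  Consequently any proof of `stub_uniformComplexBound`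
must use the percolation structure of `cornerCrossingProb` (it is an unconditional claim about the
corner model, numerically probed by exact transfer matrices in `Disproof.lean` §5), and the crux
hypothesis UM is logically idle in line `Sketch` (UA ⊢ UM by Cauchy estimates).
Refs: the Bernstein/Markov phenomenon behind the example is classical (polynomials bounded on a real
interval grow like `ρ^deg` off it); cf. V. Beffara, Progr. Probab. 60 (2008) §5.2 for why only
first-order marginality is expected to be accessible.
-/

noncomputable section

namespace Summit.CriticalPhenomena.CardyFormulaZ2.Theorems.SegmentOpen.Negative

open Set Filter Topology Complex Polynomial

/-- The logistic polynomial `q = 4X(1-X)` evaluates to `4t(1-t)`. [folklore] -/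
theorem eval_logistic (t : ℝ) : (C (4 : ℝ) * X * (1 - X)).eval t = 4 * t * (1 - t) := by
  simp only [eval_mul, eval_C, eval_X, eval_sub, eval_one]

/-- `0 ≤ 4t(1-t) ≤ 1` on `[0,1]`. [folklore] -/
theorem logistic_mem_Icc {t : ℝ} (ht : t ∈ Icc (0 : ℝ) 1) : 4 * t * (1 - t) ∈ Icc (0 : ℝ) 1 := by
  obtain ⟨h0, h1⟩ := ht
  constructor
  · have : 0 ≤ 1 - t := by linarith
    positivity
  · nlinarith [sq_nonneg (2 * t - 1)]

/-- Real evaluation of the witness `p_n = (n+1)⁻¹ · q^{n+1}`. [folklore] -/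
theorem eval_witness (n : ℕ) (t : ℝ) :
    (C (1 / ((n : ℝ) + 1)) * (C (4 : ℝ) * X * (1 - X)) ^ (n + 1)).eval t =
      1 / ((n : ℝ) + 1) * (4 * t * (1 - t)) ^ (n + 1) := by
  rw [eval_mul, eval_C, eval_pow, eval_logistic]

/-- Complex evaluation of the witness. [folklore] -/
theorem eval_map_witness (n : ℕ) (z : ℂ) :
    ((C (1 / ((n : ℝ) + 1)) * (C (4 : ℝ) * X * (1 - X)) ^ (n + 1)).map (algebraMap ℝ ℂ)).eval z =
      ((1 / ((n : ℝ) + 1) : ℝ) : ℂ) * (4 * z * (1 - z)) ^ (n + 1) := by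
  rw [eval_map, eval₂_mul, eval₂_C, eval₂_pow, eval₂_mul, eval₂_mul, eval₂_C, eval₂_X, eval₂_sub,
    eval₂_one, eval₂_X, Complex.coe_algebraMap]
  push_cast
  ring

/-- The witness is `4`-Lipschitz on `[0,1]` (its derivative is `(4t(1-t))^n (4 - 8t)`). [folklore] -/
theorem witness_lipschitz (n : ℕ) {s t : ℝ} (hs : s ∈ Icc (0 : ℝ) 1) (ht : t ∈ Icc (0 : ℝ) 1) :
    |1 / ((n : ℝ) + 1) * (4 * t * (1 - t)) ^ (n + 1) - 1 / ((n : ℝ) + 1) * (4 * s * (1 - s)) ^ (n + 1)|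
      ≤ 4 * |t - s| := by
  set f : ℝ → ℝ := fun u => 1 / ((n : ℝ) + 1) * (4 * u * (1 - u)) ^ (n + 1) with hf
  have hn : (n : ℝ) + 1 ≠ 0 := by positivity
  have hderiv : ∀ u : ℝ, HasDerivAt f ((4 * u * (1 - u)) ^ n * (4 - 8 * u)) u := by
    intro u
    have h1 : HasDerivAt (fun u : ℝ => 4 * u) 4 u := by
      have := (hasDerivAt_id' u).const_mul (4 : ℝ)
      simpa using this
    have h2 : HasDerivAt (fun u : ℝ => 1 - u) (-1) u := (hasDerivAt_id' u).const_sub 1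
    have h3 : HasDerivAt (fun u : ℝ => 4 * u * (1 - u)) (4 * (1 - u) + 4 * u * (-1)) u := h1.mul h2
    have h4 := (h3.pow (n + 1)).const_mul (1 / ((n : ℝ) + 1))
    refine h4.congr_deriv ?_
    simp only [Nat.add_sub_cancel]
    field_simp
    push_cast
    ring
  have hbound : ∀ u ∈ Icc (0 : ℝ) 1, ‖(4 * u * (1 - u)) ^ n * (4 - 8 * u)‖ ≤ 4 := by
    intro u hu
    have hq := logistic_mem_Icc hu
    rw [Real.norm_eq_abs, abs_mul, abs_of_nonneg (pow_nonneg hq.1 n)]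
    have hp : (4 * u * (1 - u)) ^ n ≤ 1 := pow_le_one₀ hq.1 hq.2
    have ha : |4 - 8 * u| ≤ 4 := by
      rw [abs_le]; constructor <;> linarith [hu.1, hu.2]
    calc (4 * u * (1 - u)) ^ n * |4 - 8 * u| ≤ 1 * 4 := mul_le_mul hp ha (abs_nonneg _) zero_le_one
      _ = 4 := one_mul 4
  have key := (convex_Icc (0 : ℝ) 1).norm_image_sub_le_of_norm_hasDerivWithin_le
    (fun u _ => (hderiv u).hasDerivWithinAt) hbound hs ht
  simpa [hf, Real.norm_eq_abs] using key

/-- **A marginal family that is not uniformly analytic.**  There is a sequence of real polynomials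
`p_n` (think: crossing polynomials at mesh `1/n`) with values in `[0,1]` on `[0,1]`, uniformly
`4`-Lipschitz on `[0,1]` (the UniformMarginality shape, `η = ε/4`), whose complexifications are
unbounded on EVERY disc around `t₀ = 1/2`: `p_n = (4X(1-X))^{n+1}/(n+1)`. [folklore] -/
theorem exists_marginal_family_not_uniformComplexBound :
    ∃ p : ℕ → Polynomial ℝ,
      (∀ (n : ℕ) (t : ℝ), t ∈ Icc (0 : ℝ) 1 → (p n).eval t ∈ Icc (0 : ℝ) 1) ∧
      (∀ (n : ℕ) (s t : ℝ), s ∈ Icc (0 : ℝ) 1 → t ∈ Icc (0 : ℝ) 1 →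
        |(p n).eval t - (p n).eval s| ≤ 4 * |t - s|) ∧
      ∀ r > 0, ∀ K : ℝ, ∃ n : ℕ, ∃ z ∈ Metric.ball (((1 / 2 : ℝ)) : ℂ) r,
        K < ‖((p n).map (algebraMap ℝ ℂ)).eval z‖ := by
  refine ⟨fun n => C (1 / ((n : ℝ) + 1)) * (C (4 : ℝ) * X * (1 - X)) ^ (n + 1), ?_, ?_, ?_⟩
  · intro n t ht
    rw [eval_witness]
    have hq := logistic_mem_Icc ht
    have hn : (0 : ℝ) < (n : ℝ) + 1 := by positivity
    constructor
    · exact mul_nonneg (by positivity) (pow_nonneg hq.1 _)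
    · calc 1 / ((n : ℝ) + 1) * (4 * t * (1 - t)) ^ (n + 1) ≤ 1 / ((n : ℝ) + 1) * 1 := by
            gcongr; exact pow_le_one₀ hq.1 hq.2
        _ ≤ 1 := by rw [mul_one, div_le_one hn]; linarith
  · intro n s t hs ht
    rw [eval_witness, eval_witness]
    exact witness_lipschitz n hs ht
  · intro r hr K
    -- at `z = 1/2 + (r/2) i`: `4z(1-z) = 1 + r² =: b > 1`, and `b^{n+1}/(n+1) → ∞`
    set b : ℝ := 1 + r ^ 2 with hb
    have hb1 : 1 < b := by rw [hb]; nlinarith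
    have hlim : Tendsto (fun m : ℕ => (m : ℝ) ^ 1 / b ^ m) atTop (𝓝 0) :=
      tendsto_pow_const_div_const_pow_of_one_lt 1 hb1
    set K' : ℝ := max K 1 with hK'
    have hK'pos : 0 < K' := lt_of_lt_of_le one_pos (le_max_right _ _)
    have hev : ∀ᶠ m : ℕ in atTop, (m : ℝ) ^ 1 / b ^ m < 1 / K' :=
      hlim (Iio_mem_nhds (by positivity))
    obtain ⟨m, hm, hm1⟩ := (hev.and (eventually_ge_atTop 1)).exists
    obtain ⟨n, rfl⟩ : ∃ n, m = n + 1 := ⟨m - 1, by omega⟩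
    set z : ℂ := ((1 / 2 : ℝ) : ℂ) + ((r / 2 : ℝ) : ℂ) * I with hz
    refine ⟨n, z, ?_, ?_⟩
    · rw [Metric.mem_ball, dist_eq_norm, hz, add_sub_cancel_left, norm_mul, Complex.norm_real,
        Complex.norm_I, mul_one, Real.norm_of_nonneg (by positivity)]
      linarith
    · have hw : (4 : ℂ) * z * (1 - z) = (b : ℂ) := by
        have : (4 : ℂ) * z * (1 - z) = 1 - 4 * (((r / 2 : ℝ) : ℂ) * I) ^ 2 := by rw [hz]; push_cast; ring
        rw [this, mul_pow, Complex.I_sq, hb]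
        push_cast
        ring
      rw [eval_map_witness, hw, norm_mul, norm_pow, Complex.norm_real, Complex.norm_real,
        Real.norm_of_nonneg (by positivity), Real.norm_of_nonneg (by positivity)]
      have hn : (0 : ℝ) < ((n + 1 : ℕ) : ℝ) := by positivity
      rw [pow_one, div_lt_div_iff₀ (by positivity) hK'pos, one_mul] at hm
      have hK : K ≤ K' := le_max_left _ _
      have : K' < 1 / ((n : ℝ) + 1) * b ^ (n + 1) := by
        rw [one_div_mul_eq_div, lt_div_iff₀ (by positivity)]
        push_cast at hm
        linarith
      linarith

/-- **UM ⇏ UA in the abstract** (refutation of the natural soft route to `stub_uniformComplexBound`):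
it is NOT true that every `[0,1]`-valued polynomial family with the UniformMarginality shape
(equicontinuity on `[0,1]`, uniformly in the index) is bounded on a complex disc around `t₀ = 1/2`
uniformly in the index.  So S4 of line `Sketch` is a genuinely stronger, model-specific claim than
the crux hypothesis. [folklore] -/
theorem not_uniformComplexBound_of_marginal_abstract :
    ¬ ∀ p : ℕ → Polynomial ℝ,
        (∀ (n : ℕ) (t : ℝ), t ∈ Icc (0 : ℝ) 1 → (p n).eval t ∈ Icc (0 : ℝ) 1) →
        (∀ ε > 0, ∃ η > 0, ∀ (n : ℕ) (s t : ℝ), s ∈ Icc (0 : ℝ) 1 → t ∈ Icc (0 : ℝ) 1 →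
          |t - s| < η → |(p n).eval t - (p n).eval s| < ε) →
        ∃ r > 0, ∃ K : ℝ, ∀ (n : ℕ), ∀ z ∈ Metric.ball (((1 / 2 : ℝ)) : ℂ) r,
          ‖((p n).map (algebraMap ℝ ℂ)).eval z‖ ≤ K := by
  intro h
  obtain ⟨p, hval, hlip, hblow⟩ := exists_marginal_family_not_uniformComplexBound
  have hUM : ∀ ε > 0, ∃ η > 0, ∀ (n : ℕ) (s t : ℝ), s ∈ Icc (0 : ℝ) 1 → t ∈ Icc (0 : ℝ) 1 →
      |t - s| < η → |(p n).eval t - (p n).eval s| < ε := by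
    intro ε hε
    refine ⟨ε / 4, by positivity, fun n s t hs ht hst => ?_⟩
    calc |(p n).eval t - (p n).eval s| ≤ 4 * |t - s| := hlip n s t hs ht
      _ < 4 * (ε / 4) := by gcongr
      _ = ε := by ring
  obtain ⟨r, hr, K, hK⟩ := h p hval hUM
  obtain ⟨n, z, hz, hlt⟩ := hblow r hr K
  exact (lt_irrefl K) (hlt.trans_le (hK n z hz))

end Summit.CriticalPhenomena.CardyFormulaZ2.Theorems.SegmentOpen.Negative

end
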